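import Summits.AtomisticToContinuum.HydrodynamicLimit.Theorems.StiffCollisionalRelaxationAprioriBoundsMesoOccupationVarianceEquilibrium
import HarnessLib

/-!
# Tools for the one-body dock of the stub `occupationVariance` (line `meso-chebyshev-window`, crux `AprioriBounds`,
stmt-AtomisticToContinuum-14827), part 1: Cauchy–Schwarz in time and the velocity-tail sandwich

Supporting file (`--supports stmt-AtomisticToContinuum-14827`) of the lead prover of the line
`Cruxes/AprioriBounds/Lines/meso_chebyshev_window.lean` (lead c10; stub worker of stub 6 `stub_pairDecorrelation`, whose
r2 text is `stub_occupationVariance`: under the crux prefix, for every level `K`, `Var_{P_N}(occ_K) → 0` for the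
time-integrated one-particle tail occupation `occ_K(z) = ∫₀ᵗ frac_K(Φ_s z) ds`; the r3 pair form
`Cov_{P_N}(ζ₀^K, ζ₁^K) → 0` is equivalent to it by exchangeability, glue owned by the lead).

THE POINT (with the companion `…MesoPairDecorrelationDock.lean`): the time-window variance stub is not a two-time /
second-marginal statement in disguise — it REDUCES TO FIXED-TIME ONE-PARTICLE INFORMATION.

* §1 `pdk_variance_occ_le`: for EVERY probability law `P` carried by the good set of a flow and every `t ≥ 0`,
  `Var_P(occ_K) ≤ t · ∫₀ᵗ Var_P(frac_K ∘ Φ_s) ds` — Cauchy–Schwarz in time on each good orbit against the deterministic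
  centring `s ↦ E_P(frac_K ∘ Φ_s)` (jointly measurable, `AdiabatCeiling.aemeasurable_comp_flow_prod`), then Tonelli;
  NO invariance of `P` is used (the equilibrium rung `variance_occ_le_const` is the invariant case).  Hence, by
  dominated convergence in time (`pdk_variance_occ_tendsto_zero`): fixed-time variances `→ 0` on `[0, t]` force
  `Var_{P_N}(occ_K) → 0`; in the crux prefix this is `occupationVariance_of_fixedTimeTailVariance`, whose conclusion is
  the registered r2 statement `stub_occupationVariance` VERBATIM (third hypothesis of the landed capstone
  `AprioriBounds_of_KRC_GT_occupationVariance`).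
* §2–§3 (for the companion): the continuous sandwich `ψ⁻_ε ≤ 𝟙{K ≤ |v|²} ≤ ψ⁻_ε + h_ε` of the tail indicator by
  unit-clamp ramps (`pdk_sandwich`) and the variance bound for a sandwiched bounded statistic from the convergence in
  probability of the two continuous statistics (`pdk_variance_le_of_sandwich`).  The companion feeds them with the
  LIVE item `AnosovDiceHopf.MaxwellianOneBodyInBand` (stmt-AtomisticToContinuum-17603).

No new definitions, no named facts; axioms `propext`, `Classical.choice`, `Quot.sound`.
-/

noncomputable section

open MeasureTheory ProbabilityTheory Filter Set Topology
open scoped ENNReal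

namespace Summit.AtomisticToContinuum.HydrodynamicLimit.Theorems.MesoChebyshevWindow

open Literature.MathematicalPhysics.KineticTheory Literature.Analysis.FluidPDE
open Summit.AtomisticToContinuum.HydrodynamicLimit.Theorems.VisitLedgerUpscattering (Cfg Flow Flows NiceProfiles)
open Summit.AtomisticToContinuum.HydrodynamicLimit.Theorems.FibreDeficitTransfer

/-! ## §1 Cauchy–Schwarz in time, out of equilibrium -/

/-- **`Var_P(occ_K) ≤ t · ∫₀ᵗ Var_P(frac_K ∘ Φ_s) ds` for every law carried by the good set.**  For a hard-sphere
flow `Φ`, a probability law `P` with `P(goodᶜ) = 0`, `t ≥ 0` and a level `K`, the variance of the time-integrated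
tail occupation `occ_K(z) = ∫₀ᵗ frac_K(Φ_s z) ds` is at most `t` times the time integral of the FIXED-TIME
variances `V(s) = Var_P(frac_K ∘ Φ_s)` (Cauchy–Schwarz in time on each good orbit against the deterministic centring
`s ↦ E_P frac_K ∘ Φ_s`, then Tonelli; no invariance of `P` is used); moreover `s ↦ V(s)` is a.e.-measurable on
`[0, t]` and `≤ 1` (recorded for the dominated-convergence step). -/
theorem pdk_variance_occ_le {σ : ℝ} {N : ℕ}
    (Φ : HardSphereFlow (Torus.geometry (Fin 3)) (hsDiameter σ N) (N + 1))
    (P : Measure (Cfg N)) [IsProbabilityMeasure P] (hgood : P Φ.goodᶜ = 0) {t : ℝ} (ht : 0 ≤ t) (K : ℝ) :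
    (AEMeasurable (fun s => ENNReal.ofReal (variance (fun z => frac K (Φ.flow s z)) P))
        (volume.restrict (Icc 0 t)) ∧
      ∀ s, ENNReal.ofReal (variance (fun z => frac K (Φ.flow s z)) P) ≤ 1) ∧
    variance (fun z => (∫⁻ s in Icc 0 t, ENNReal.ofReal (frac K (Φ.flow s z))).toReal) P ≤
      t * (∫⁻ s in Icc 0 t, ENNReal.ofReal (variance (fun z => frac K (Φ.flow s z)) P)).toReal := by
  set F : Cfg N → ℝ := frac K with hF
  have hFm : Measurable F := measurable_frac K
  have hF01 : ∀ w, F w ∈ Icc (0 : ℝ) 1 := fun w => frac_mem_Icc K w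
  set ν : Measure ℝ := volume.restrict (Icc 0 t) with hν
  have hνuniv : ν univ = ENNReal.ofReal t := by
    rw [hν, Measure.restrict_apply_univ, Real.volume_Icc, sub_zero]
  haveI : IsFiniteMeasure ν := ⟨by rw [hνuniv]; exact ENNReal.ofReal_lt_top⟩
  have hνreal : ν.real univ = t := by rw [measureReal_def, hνuniv, ENNReal.toReal_ofReal ht]
  -- the observable along the flow and its fixed-time centring
  set X : ℝ → Cfg N → ℝ := fun s z => F (Φ.flow s z) with hX
  have hXm : ∀ s, Measurable (X s) := fun s => hFm.comp (Φ.measurable_flow s)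
  have hX01 : ∀ s z, X s z ∈ Icc (0 : ℝ) 1 := fun s z => hF01 _
  set c : ℝ → ℝ := fun s => ∫ z, X s z ∂P with hc
  have hc01 : ∀ s, c s ∈ Icc (0 : ℝ) 1 := fun s =>
    ⟨integral_nonneg fun z => (hX01 s z).1,
      (integral_mono_of_nonneg (Eventually.of_forall fun z => (hX01 s z).1) (integrable_const 1)
        (Eventually.of_forall fun z => (hX01 s z).2)).trans (by simp)⟩
  -- joint a.e.-measurability of `(z, s) ↦ X s z`, of the centring, of the squared deviation
  have hjoint : AEMeasurable (fun p : Cfg N × ℝ => X p.2 p.1) (P.prod ν) := by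
    have h := AdiabatCeiling.aemeasurable_comp_flow_prod Φ hFm.ennreal_ofReal hgood ν
    have h2 : (fun p : Cfg N × ℝ => X p.2 p.1) =
        fun p => (ENNReal.ofReal (F (Φ.flow p.2 p.1))).toReal := by
      funext p
      rw [ENNReal.toReal_ofReal (hF01 _).1]
    rw [h2]
    exact h.ennreal_toReal
  have hcm : AEMeasurable c ν := by
    have h2 : c = fun s => (∫⁻ z, ENNReal.ofReal (X s z) ∂P).toReal := by
      funext s
      exact integral_eq_lintegral_of_nonneg_ae (Eventually.of_forall fun z => (hX01 s z).1)
        (hXm s).aestronglyMeasurable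
    rw [h2]
    exact hjoint.ennreal_ofReal.lintegral_prod_left'.ennreal_toReal
  have hdev : AEMeasurable (fun p : Cfg N × ℝ => ENNReal.ofReal ((X p.2 p.1 - c p.2) ^ 2)) (P.prod ν) :=
    ((hjoint.sub hcm.comp_snd).pow_const 2).ennreal_ofReal
  -- fixed-time variance in `lintegral` form, and its bound by `1`
  have hvar : ∀ s, ∫⁻ z, ENNReal.ofReal ((X s z - c s) ^ 2) ∂P = ENNReal.ofReal (variance (X s) P) := by
    intro s
    have hmem : MemLp (X s) 2 P :=
      memLp_of_bounded (Eventually.of_forall (hX01 s)) (hXm s).aestronglyMeasurable 2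
    rw [ofReal_variance hmem, evariance_eq_lintegral_ofReal]
  have hvar_le : ∀ s, ENNReal.ofReal (variance (X s) P) ≤ 1 := fun s => by
    rw [← hvar s]
    calc ∫⁻ z, ENNReal.ofReal ((X s z - c s) ^ 2) ∂P ≤ ∫⁻ _z, 1 ∂P := lintegral_mono fun z => by
          rw [← ENNReal.ofReal_one]
          refine ENNReal.ofReal_le_ofReal ?_
          have h1 := hX01 s z
          have h2 := hc01 s
          nlinarith [h1.1, h1.2, h2.1, h2.2]
      _ = 1 := by rw [lintegral_one, measure_univ]
  refine ⟨⟨hdev.lintegral_prod_left'.congr (Eventually.of_forall fun s => hvar s), hvar_le⟩, ?_⟩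
  -- the occupation and the constant centring
  set occ : Cfg N → ℝ := fun z => (∫⁻ s, ENNReal.ofReal (F (Φ.flow s z)) ∂ν).toReal with hocc
  set C : ℝ := ∫ s, c s ∂ν with hC
  have hci : Integrable c ν :=
    (memLp_of_bounded (Eventually.of_forall hc01) hcm.aestronglyMeasurable 1).integrable le_rfl
  -- (1) Cauchy–Schwarz in time on every good orbit
  have hpt : ∀ z ∈ Φ.good, ENNReal.ofReal ((occ z - C) ^ 2) ≤
      ENNReal.ofReal t * ∫⁻ s, ENNReal.ofReal ((X s z - c s) ^ 2) ∂ν := by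
    intro z hz
    have hfm : Measurable fun s => X s z := hFm.comp (Φ.isTrajectory z hz).measurable_torus
    have hfi : Integrable (fun s => X s z) ν :=
      (memLp_of_bounded (Eventually.of_forall fun s => hX01 s z) hfm.aestronglyMeasurable 1).integrable le_rfl
    have hg02 : ∀ s, X s z - c s ∈ Icc (-1 : ℝ) 1 := fun s => by
      have h1 := hX01 s z
      have h2 := hc01 s
      constructor <;> linarith [h1.1, h1.2, h2.1, h2.2]
    have hg2i : Integrable (fun s => (X s z - c s) ^ 2) ν :=
      (memLp_of_bounded (Eventually.of_forall hg02) (hfm.aemeasurable.sub hcm).aestronglyMeasurable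
        2).integrable_sq
    have hgi : Integrable (fun s => X s z - c s) ν := hfi.sub hci
    have hocc_eq : occ z = ∫ s, X s z ∂ν :=
      (integral_eq_lintegral_of_nonneg_ae (Eventually.of_forall fun s => (hX01 s z).1)
        hfm.aestronglyMeasurable).symm
    have hsub : occ z - C = ∫ s, (X s z - c s) ∂ν := by
      rw [integral_sub hfi hci, hocc_eq]
    have hcs := sq_integral_le_measureReal_mul_integral_sq hgi hg2i
    rw [hνreal, ← hsub] at hcs
    calc ENNReal.ofReal ((occ z - C) ^ 2)
        ≤ ENNReal.ofReal (t * ∫ s, (X s z - c s) ^ 2 ∂ν) := ENNReal.ofReal_le_ofReal hcs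
      _ = ENNReal.ofReal t * ∫⁻ s, ENNReal.ofReal ((X s z - c s) ^ 2) ∂ν := by
          rw [ENNReal.ofReal_mul ht,
            ofReal_integral_eq_lintegral_ofReal hg2i (Eventually.of_forall fun s => sq_nonneg _)]
  -- (2) Tonelli
  have hdyn : ∫⁻ z, ENNReal.ofReal ((occ z - C) ^ 2) ∂P ≤
      ENNReal.ofReal t * ∫⁻ s, ENNReal.ofReal (variance (X s) P) ∂ν := by
    calc ∫⁻ z, ENNReal.ofReal ((occ z - C) ^ 2) ∂P
        ≤ ∫⁻ z, ENNReal.ofReal t * ∫⁻ s, ENNReal.ofReal ((X s z - c s) ^ 2) ∂ν ∂P := by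
          refine lintegral_mono_ae ?_
          filter_upwards [(mem_ae_iff.2 hgood : ∀ᵐ z ∂P, z ∈ Φ.good)] with z hz using hpt z hz
      _ = ENNReal.ofReal t * ∫⁻ s, ∫⁻ z, ENNReal.ofReal ((X s z - c s) ^ 2) ∂P ∂ν := by
          rw [lintegral_const_mul'' _ (hdev.lintegral_prod_right'),
            lintegral_lintegral_swap (f := fun z s => ENNReal.ofReal ((X s z - c s) ^ 2)) hdev]
      _ = ENNReal.ofReal t * ∫⁻ s, ENNReal.ofReal (variance (X s) P) ∂ν := by
          simp_rw [hvar]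
  -- (3) `Var occ ≤ E(occ - C)²`
  have hoccm : AEStronglyMeasurable occ P :=
    ((AdiabatCeiling.aemeasurable_comp_flow_prod Φ hFm.ennreal_ofReal hgood
      ν).lintegral_prod_right').ennreal_toReal.aestronglyMeasurable
  have hcm' : AEStronglyMeasurable (fun z => occ z - C) P := hoccm.sub aestronglyMeasurable_const
  have hv2 : Var[fun z => occ z - C; P] ≤ ∫ z, (occ z - C) ^ 2 ∂P := by
    have h := variance_le_expectation_sq hcm'
    simpa only [Pi.pow_apply] using h
  have hv3 : ∫ z, (occ z - C) ^ 2 ∂P = (∫⁻ z, ENNReal.ofReal ((occ z - C) ^ 2) ∂P).toReal :=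
    integral_eq_lintegral_of_nonneg_ae (Eventually.of_forall fun z => sq_nonneg _)
      ((hoccm.aemeasurable.sub_const _).pow_const 2).aestronglyMeasurable
  have hfin : ENNReal.ofReal t * ∫⁻ s, ENNReal.ofReal (variance (X s) P) ∂ν ≠ ∞ := by
    refine ENNReal.mul_ne_top ENNReal.ofReal_ne_top (ne_of_lt ?_)
    calc ∫⁻ s, ENNReal.ofReal (variance (X s) P) ∂ν ≤ ∫⁻ _s, 1 ∂ν := lintegral_mono fun s => hvar_le s
      _ < ∞ := by rw [lintegral_one]; exact measure_lt_top ν _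
  rw [← variance_sub_const hoccm C]
  refine hv2.trans ?_
  rw [hv3]
  calc (∫⁻ z, ENNReal.ofReal ((occ z - C) ^ 2) ∂P).toReal
      ≤ (ENNReal.ofReal t * ∫⁻ s, ENNReal.ofReal (variance (X s) P) ∂ν).toReal :=
        ENNReal.toReal_mono hfin hdyn
    _ = t * (∫⁻ s, ENNReal.ofReal (variance (X s) P) ∂ν).toReal := by
        rw [ENNReal.toReal_mul, ENNReal.toReal_ofReal ht]

/-- **Dominated convergence in time.**  If the fixed-time variances `Var_{P_N}(frac_K ∘ Φ^N_s)` tend to `0` for every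
`s ∈ [0, t]`, then so does `∫₀ᵗ Var_{P_N}(frac_K ∘ Φ^N_s) ds` (they are all `≤ 1`), hence — by `pdk_variance_occ_le` — so
does the variance of the time-integrated occupation `occ_K` under any probability laws `P_N` carried by the good sets. -/
theorem pdk_variance_occ_tendsto_zero {σ : ℝ}
    (Φ : (N : ℕ) → HardSphereFlow (Torus.geometry (Fin 3)) (hsDiameter σ N) (N + 1))
    (P : (N : ℕ) → Measure (Cfg N)) (hP : ∀ N, IsProbabilityMeasure (P N))
    (hgood : ∀ N, P N (Φ N).goodᶜ = 0) {t : ℝ} (ht : 0 ≤ t) (K : ℝ)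
    (hfix : ∀ s ∈ Icc 0 t,
      Tendsto (fun N : ℕ => variance (fun z => frac K ((Φ N).flow s z)) (P N)) atTop (𝓝 0)) :
    Tendsto (fun N : ℕ => variance
      (fun z => (∫⁻ s in Icc 0 t, ENNReal.ofReal (frac K ((Φ N).flow s z))).toReal) (P N)) atTop (𝓝 0) := by
  set ν : Measure ℝ := volume.restrict (Icc 0 t) with hν
  have hνuniv : ν univ = ENNReal.ofReal t := by
    rw [hν, Measure.restrict_apply_univ, Real.volume_Icc, sub_zero]
  haveI : IsFiniteMeasure ν := ⟨by rw [hνuniv]; exact ENNReal.ofReal_lt_top⟩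
  have hmain := fun N => by
    haveI := hP N
    exact pdk_variance_occ_le (Φ N) (P N) (hgood N) ht K
  -- dominated convergence in time
  have hlim : Tendsto (fun N => ∫⁻ s, ENNReal.ofReal (variance (fun z => frac K ((Φ N).flow s z)) (P N)) ∂ν)
      atTop (𝓝 (∫⁻ _s, (0 : ℝ≥0∞) ∂ν)) := by
    refine tendsto_lintegral_of_dominated_convergence' (fun _ => 1) (fun N => (hmain N).1.1)
      (fun N => Eventually.of_forall (hmain N).1.2) ?_ ?_
    · rw [lintegral_one]
      exact (measure_lt_top ν _).ne
    · filter_upwards [(ae_restrict_mem measurableSet_Icc : ∀ᵐ s ∂ν, s ∈ Icc (0 : ℝ) t)] with s hs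
      have h := ENNReal.tendsto_ofReal (hfix s hs)
      rwa [ENNReal.ofReal_zero] at h
  rw [lintegral_zero] at hlim
  have hlim' : Tendsto (fun N => t * (∫⁻ s, ENNReal.ofReal
      (variance (fun z => frac K ((Φ N).flow s z)) (P N)) ∂ν).toReal) atTop (𝓝 0) := by
    have h := ((ENNReal.tendsto_toReal ENNReal.zero_ne_top).comp hlim).const_mul t
    simpa using h
  exact squeeze_zero (fun N => variance_nonneg _ _) (fun N => (hmain N).2) hlim'

/-- **Fixed-time variances imply the time-window variance stub** (pure measure theory, for ANY producer of the
fixed-time input): under the crux prefix, if `Var_{P_N}(frac_K ∘ Φ^N_s) → 0` for every level `K` and every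
`s ∈ [0, t]`, then `Var_{P_N}(occ_K) → 0` for every `K` — the registered statement `stub_occupationVariance` of the
line `meso-chebyshev-window` (r2 text, third hypothesis of `AprioriBounds_of_KRC_GT_occupationVariance`), with the
same thresholds `σ₀ ⊓ 1/2`, `η₁`.  Proof: `pdk_variance_occ_tendsto_zero` (Cauchy–Schwarz in time + dominated
convergence; the local Gibbs laws are probability measures carried by the good sets). -/
theorem occupationVariance_of_fixedTimeTailVariance :
    (∀ (a₀ θ₀ : T3 → ℝ) (u₀ : T3 → V3), Continuous a₀ → Continuous θ₀ → Continuous u₀ →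
      (∀ x, 0 < a₀ x) → (∀ x, 0 < θ₀ x) →
      ∃ σ₀ : ℝ, 0 < σ₀ ∧ ∃ η₁ : ℝ, 0 < η₁ ∧ ∀ σ : ℝ, 0 < σ → σ < σ₀ →
        ∀ (T : ℝ) (ρ θ : ℝ → T3 → ℝ) (u : ℝ → T3 → V3), IsHardSphereEulerSolution σ T ρ u θ →
        ∀ Φ : (N : ℕ) → HardSphereFlow (Torus.geometry (Fin 3)) (hsDiameter σ N) (N + 1),
          TendstoHydroFieldsAt (fun N => localGibbsLaw σ a₀ u₀ θ₀ N (Φ N)) Φ ρ u θ 0 →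
          ∀ t : ℝ, 0 < t → t < T → (∀ s ∈ Icc 0 t, ∀ x, 2 * ρ s x * σ ^ 3 < η₁) →
            ∀ K : ℝ, ∀ s ∈ Icc 0 t, Tendsto (fun N : ℕ => variance (fun z => frac K ((Φ N).flow s z))
              (localGibbsLaw σ a₀ u₀ θ₀ N (Φ N))) atTop (𝓝 0)) →
    ∀ (a₀ θ₀ : T3 → ℝ) (u₀ : T3 → V3), Continuous a₀ → Continuous θ₀ → Continuous u₀ →
      (∀ x, 0 < a₀ x) → (∀ x, 0 < θ₀ x) →
      ∃ σ₀ : ℝ, 0 < σ₀ ∧ ∃ η₁ : ℝ, 0 < η₁ ∧ ∀ σ : ℝ, 0 < σ → σ < σ₀ →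
        ∀ (T : ℝ) (ρ θ : ℝ → T3 → ℝ) (u : ℝ → T3 → V3), IsHardSphereEulerSolution σ T ρ u θ →
        ∀ Φ : (N : ℕ) → HardSphereFlow (Torus.geometry (Fin 3)) (hsDiameter σ N) (N + 1),
          TendstoHydroFieldsAt (fun N => localGibbsLaw σ a₀ u₀ θ₀ N (Φ N)) Φ ρ u θ 0 →
          ∀ t : ℝ, 0 < t → t < T → (∀ s ∈ Icc 0 t, ∀ x, 2 * ρ s x * σ ^ 3 < η₁) →
            ∀ K : ℝ, Tendsto (fun N : ℕ => variance
              (fun z => (∫⁻ s in Icc 0 t, ENNReal.ofReal (frac K ((Φ N).flow s z))).toReal)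
              (localGibbsLaw σ a₀ u₀ θ₀ N (Φ N))) atTop (𝓝 0) := by
  intro hfixAll a₀ θ₀ u₀ ha hθ hu ha0 hθ0
  obtain ⟨σ₀, hσ₀, η₁, hη₁, hfix⟩ := hfixAll a₀ θ₀ u₀ ha hθ hu ha0 hθ0
  refine ⟨min σ₀ (1 / 2), lt_min hσ₀ one_half_pos, η₁, hη₁, ?_⟩
  intro σ hσ hσlt T ρ θ u hsol Φ h0 t ht htT hchamber K
  have hσσ₀ : σ < σ₀ := hσlt.trans_le (min_le_left _ _)
  have hσ2 : σ ≤ 1 / 2 := (hσlt.trans_le (min_le_right _ _)).le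
  have hgood : ∀ N, localGibbsLaw σ a₀ u₀ θ₀ N (Φ N) (Φ N).goodᶜ = 0 := fun N => by
    rw [localGibbsLaw_eq]
    exact (localGibbsMeasure_absolutelyContinuous σ a₀ u₀ θ₀ N (Φ N)) (Φ N).measure_compl_good
  exact pdk_variance_occ_tendsto_zero Φ (fun N => localGibbsLaw σ a₀ u₀ θ₀ N (Φ N))
    (fun N => isProbabilityMeasure_localGibbsLaw ha hθ hu ha0 hθ0 hσ2 N (Φ N)) hgood ht.le K
    (hfix σ hσ hσσ₀ T ρ θ u hsol Φ h0 t ht htT hchamber K)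

/-! ## §2 Continuous sandwich of the velocity-tail indicator -/

/-- The unit clamp `r ↦ max 0 (min 1 r)` (values in `[0, 1]`, `= 1` above `1`, `= 0` below `0`) is continuous. -/
theorem pdk_continuous_clamp : Continuous fun r : ℝ => max 0 (min 1 r) :=
  continuous_const.max (continuous_const.min continuous_id)

/-- **The sandwich.**  For `ε > 0` and a level `K`, the lower ramp `ψ⁻(r) = clamp((r − K)/ε)` and the shell bump
`h(r) = clamp((r − K + ε)/ε) − clamp((r − K − ε)/ε)` satisfy `0 ≤ 𝟙{K ≤ r} − ψ⁻(r) ≤ h(r) ≤ 1`, `0 ≤ ψ⁻ ≤ 1`, and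
`h` vanishes off the shell `K − ε < r < K + 2ε`. -/
theorem pdk_sandwich {ε : ℝ} (hε : 0 < ε) (K r : ℝ) :
    (0 ≤ (if K ≤ r then (1 : ℝ) else 0) - max 0 (min 1 ((r - K) / ε))) ∧
    ((if K ≤ r then (1 : ℝ) else 0) - max 0 (min 1 ((r - K) / ε)) ≤
      max 0 (min 1 ((r - (K - ε)) / ε)) - max 0 (min 1 ((r - (K + ε)) / ε))) ∧
    (max 0 (min 1 ((r - (K - ε)) / ε)) - max 0 (min 1 ((r - (K + ε)) / ε)) ≤ 1) ∧
    (0 ≤ max 0 (min 1 ((r - (K - ε)) / ε)) - max 0 (min 1 ((r - (K + ε)) / ε))) ∧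
    (¬ (K - ε < r ∧ r < K + 2 * ε) →
      max 0 (min 1 ((r - (K - ε)) / ε)) - max 0 (min 1 ((r - (K + ε)) / ε)) = 0) := by
  have c01 : ∀ x : ℝ, max 0 (min 1 x) ∈ Icc (0 : ℝ) 1 := fun x =>
    ⟨le_max_left _ _, max_le zero_le_one (min_le_left _ _)⟩
  have c1 : ∀ {x : ℝ}, 1 ≤ x → max 0 (min 1 x) = 1 := fun h => by rw [min_eq_left h, max_eq_right zero_le_one]
  have c0 : ∀ {x : ℝ}, x ≤ 0 → max 0 (min 1 x) = 0 := fun h => max_eq_left ((min_le_right _ _).trans h)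
  have hab : (r - (K + ε)) / ε ≤ (r - (K - ε)) / ε := div_le_div_of_nonneg_right (by linarith) hε.le
  have hA := c01 ((r - (K - ε)) / ε)
  have hB := c01 ((r - (K + ε)) / ε)
  have hM := c01 ((r - K) / ε)
  have hh0 : 0 ≤ max 0 (min 1 ((r - (K - ε)) / ε)) - max 0 (min 1 ((r - (K + ε)) / ε)) :=
    sub_nonneg.2 (max_le_max le_rfl (min_le_min le_rfl hab))
  refine ⟨?_, ?_, by linarith [hA.2, hB.1], hh0, ?_⟩
  · by_cases hKr : K ≤ r
    · rw [if_pos hKr]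
      linarith [hM.2]
    · rw [if_neg hKr, c0 (div_nonpos_of_nonpos_of_nonneg (by linarith [lt_of_not_ge hKr]) hε.le)]
      norm_num
  · by_cases hKr : K ≤ r
    · rw [if_pos hKr]
      by_cases hr2 : K + ε ≤ r
      · rw [c1 (show (1 : ℝ) ≤ (r - K) / ε by rw [le_div_iff₀ hε]; linarith)]
        linarith
      · have h1 : max 0 (min 1 ((r - (K - ε)) / ε)) = 1 :=
          c1 (by rw [le_div_iff₀ hε]; linarith)
        have h2 : max 0 (min 1 ((r - (K + ε)) / ε)) = 0 :=
          c0 (div_nonpos_of_nonpos_of_nonneg (by linarith [lt_of_not_ge hr2]) hε.le)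
        rw [h1, h2]
        linarith [hM.1]
    · rw [if_neg hKr, c0 (div_nonpos_of_nonpos_of_nonneg (by linarith [lt_of_not_ge hKr]) hε.le)]
      linarith
  · intro hnot
    rcases le_or_gt r (K - ε) with hr | hr
    · have h1 : max 0 (min 1 ((r - (K - ε)) / ε)) = 0 :=
        c0 (div_nonpos_of_nonpos_of_nonneg (by linarith) hε.le)
      have h2 : max 0 (min 1 ((r - (K + ε)) / ε)) = 0 :=
        c0 (div_nonpos_of_nonpos_of_nonneg (by linarith) hε.le)
      rw [h1, h2, sub_zero]
    · have hr2 : K + 2 * ε ≤ r := by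
        by_contra h
        exact hnot ⟨hr, lt_of_not_ge h⟩
      have h1 : max 0 (min 1 ((r - (K - ε)) / ε)) = 1 :=
        c1 (by rw [le_div_iff₀ hε]; linarith)
      have h2 : max 0 (min 1 ((r - (K + ε)) / ε)) = 1 :=
        c1 (by rw [le_div_iff₀ hε]; linarith)
      rw [h1, h2, sub_self]

/-! ## §3 A variance bound from a sandwich in probability -/

/-- **Variance of a sandwiched bounded statistic.**  On a probability space let `X, X⁻, Y` be measurable with
`0 ≤ X − X⁻ ≤ Y ≤ 1`, `|X⁻| ≤ 1`.  Then for all reals `m⁻`, `m_Y ≥ 0` and `δ > 0`,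
`Var X ≤ 2 (m_Y + δ + P{δ < |Y − m_Y|}) + 2 (δ² + (1 + |m⁻|)² P{δ < |X⁻ − m⁻|})`
(`Var X ≤ E(X − m⁻)² ≤ 2E(X − X⁻)² + 2E(X⁻ − m⁻)²`, `(X − X⁻)² ≤ Y`, and the two obvious splittings). -/
theorem pdk_variance_le_of_sandwich {Ω : Type*} [MeasurableSpace Ω] (P : Measure Ω) [IsProbabilityMeasure P]
    {X Xm Y : Ω → ℝ} (hX : Measurable X) (hXm : Measurable Xm) (hY : Measurable Y)
    (h0 : ∀ ω, 0 ≤ X ω - Xm ω) (h1 : ∀ ω, X ω - Xm ω ≤ Y ω) (hY1 : ∀ ω, Y ω ≤ 1)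
    (hXm1 : ∀ ω, |Xm ω| ≤ 1) (mm : ℝ) {mY : ℝ} (hmY : 0 ≤ mY) {δ : ℝ} (hδ : 0 < δ) :
    variance X P ≤ 2 * (mY + δ + P.real {ω | δ < |Y ω - mY|}) +
      2 * (δ ^ 2 + (1 + |mm|) ^ 2 * P.real {ω | δ < |Xm ω - mm|}) := by
  set B1 : Set Ω := {ω | δ < |Y ω - mY|} with hB1def
  set B2 : Set Ω := {ω | δ < |Xm ω - mm|} with hB2def
  have hB1 : MeasurableSet B1 :=
    measurableSet_lt measurable_const (continuous_abs.measurable.comp (hY.sub_const mY))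
  have hB2 : MeasurableSet B2 :=
    measurableSet_lt measurable_const (continuous_abs.measurable.comp (hXm.sub_const mm))
  -- pointwise bound
  set R : Ω → ℝ := fun ω => (2 * (mY + δ) + 2 * δ ^ 2) + 2 * B1.indicator 1 ω +
    (2 * (1 + |mm|) ^ 2) * B2.indicator 1 ω with hR
  have hpt : ∀ ω, (X ω - mm) ^ 2 ≤ R ω := by
    intro ω
    have hY' : Y ω ≤ mY + δ + B1.indicator 1 ω := by
      by_cases hω : ω ∈ B1
      · rw [indicator_of_mem hω, Pi.one_apply]
        linarith [hY1 ω]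
      · rw [indicator_of_notMem hω]
        have h : |Y ω - mY| ≤ δ := not_lt.1 hω
        linarith [(abs_le.1 h).2]
    have hXm' : (Xm ω - mm) ^ 2 ≤ δ ^ 2 + (1 + |mm|) ^ 2 * B2.indicator 1 ω := by
      by_cases hω : ω ∈ B2
      · rw [indicator_of_mem hω, Pi.one_apply, mul_one]
        have h : |Xm ω - mm| ≤ 1 + |mm| := (abs_sub _ _).trans (by linarith [hXm1 ω])
        have h2 : (Xm ω - mm) ^ 2 ≤ (1 + |mm|) ^ 2 := by
          rw [← sq_abs (Xm ω - mm)]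
          exact pow_le_pow_left₀ (abs_nonneg _) h 2
        linarith [sq_nonneg δ]
      · rw [indicator_of_notMem hω, mul_zero, add_zero]
        have h : |Xm ω - mm| ≤ δ := not_lt.1 hω
        rw [← sq_abs (Xm ω - mm)]
        exact pow_le_pow_left₀ (abs_nonneg _) h 2
    have hsq : (X ω - Xm ω) ^ 2 ≤ Y ω := by nlinarith [h0 ω, h1 ω, hY1 ω]
    have hsplit : (X ω - mm) ^ 2 ≤ 2 * (X ω - Xm ω) ^ 2 + 2 * (Xm ω - mm) ^ 2 := by
      nlinarith [sq_nonneg ((X ω - Xm ω) - (Xm ω - mm))]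
    rw [hR]
    simp only
    nlinarith [hsq, hY', hXm', hsplit, sq_nonneg (1 + |mm|)]
  -- integrate
  have hXmeas : AEStronglyMeasurable X P := hX.aestronglyMeasurable
  have hv1 : variance X P = variance (fun ω => X ω - mm) P := (variance_sub_const hXmeas mm).symm
  have hcm' : AEStronglyMeasurable (fun ω => X ω - mm) P := hXmeas.sub aestronglyMeasurable_const
  have hv2 : variance (fun ω => X ω - mm) P ≤ ∫ ω, (X ω - mm) ^ 2 ∂P := by
    have h := variance_le_expectation_sq hcm'
    simpa only [Pi.pow_apply] using h
  have hi1 : Integrable (B1.indicator (1 : Ω → ℝ)) P := (integrable_const (1 : ℝ)).indicator hB1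
  have hi2 : Integrable (B2.indicator (1 : Ω → ℝ)) P := (integrable_const (1 : ℝ)).indicator hB2
  have hi1' : Integrable (fun ω => 2 * B1.indicator (1 : Ω → ℝ) ω) P := hi1.const_mul 2
  have hi2' : Integrable (fun ω => (2 * (1 + |mm|) ^ 2) * B2.indicator (1 : Ω → ℝ) ω) P := hi2.const_mul _
  have h12 : Integrable (fun ω => (2 * (mY + δ) + 2 * δ ^ 2) + 2 * B1.indicator (1 : Ω → ℝ) ω) P :=
    (integrable_const _).add hi1'
  have hRi : Integrable R P := h12.add hi2'
  have hRint : ∫ ω, R ω ∂P = (2 * (mY + δ) + 2 * δ ^ 2) + 2 * P.real B1 + (2 * (1 + |mm|) ^ 2) * P.real B2 := by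
    rw [hR]
    simp only
    rw [integral_add h12 hi2', integral_add (integrable_const _) hi1', integral_const_mul, integral_const_mul,
      integral_indicator_one hB1, integral_indicator_one hB2, integral_const, smul_eq_mul, probReal_univ, one_mul]
  rw [hv1]
  refine hv2.trans ((integral_mono_of_nonneg (Eventually.of_forall fun ω => sq_nonneg _) hRi
    (Eventually.of_forall hpt)).trans ?_)
  rw [hRint]
  nlinarith [measureReal_nonneg (μ := P) (s := B1), measureReal_nonneg (μ := P) (s := B2), sq_nonneg (1 + |mm|)]


end Summit.AtomisticToContinuum.HydrodynamicLimit.Theorems.MesoChebyshevWindow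

end
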